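import Summits.HubbardSuperconductivity.HubbardSuperconductivity.Theorems.WeakCouplingBCSWcbcsSourcedFreeGasCooperLogBdG
import Summits.HubbardSuperconductivity.HubbardSuperconductivity.Theorems.WeakCouplingBCSWcbcsSourcedFreeGasCooperLogFermiSea
import Literature.MathematicalPhysics.QuantumLattice.TorusFermiWeightSum

/-!
# Route `WeakCouplingBCS`, support item `WcbcsSourcedFreeGasCooperLog`
# (stmt-HubbardSuperconductivity-1210): the Cooper logarithm of the sourced free gas — closing file

We PROVE the route decl `Summit.HubbardSuperconductivity.HubbardSuperconductivity.Theses.WeakCouplingBCS.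
WcbcsSourcedFreeGasCooperLog` (type spelled out structurally; this module does not import the Theses
file, so the gate can link `WcbcsSourcedFreeGasCooperLog_holds` by importing it there):
for every real form factor `g` and doping `δ ∈ (0,1)` there are `C`, `h₀ ∈ (0,1)` such that for
`0 < h < h₀` and all large `L` (threshold depending on `h`), with `μ = μ_L` the canonical free Fermi
(shell) level of `N_L = 2⌊(1-δ)(L+1)²/2⌋` electrons on the torus of side `L+1`,

  `E₀^{(N_L, S^z=0)}(H⁰) - μ N_L - C h² log(1/h) (L+1)² ≤ Re ⟨φ, (K_μ - h(Δ_g + Δ_g†)) φ⟩`  (`‖φ‖ = 1`),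

`H⁰ = hubbardTorus 2 (L+1) 1 0`, `K_μ = hubbardTorusWith 2 (L+1) 1 0 μ`, `Δ_g = pairField g (L+1)`.

Assembly of three proved ingredients:
1. `free_sectorEnergy_sub_fermiLevel_mul_le` (`…CooperLogFermiSea`): `E₀^{sec} - μ_L N_L ≤ 2Σ_k min(ξ_k, 0)`;
2. `sum_bdgLevel_le_re_rayleigh_sourcedFreeTorus` (`…CooperLogBdG`): `⟨φ,(K_μ - hO_g)φ⟩ ≥ Σ_k (ξ_k - E_k)`,
   `E_k = √(ξ_k² + h²w_g(k)²)`, and `ξ - E = 2min(ξ,0) - (E - |ξ|)`;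
3. the Cooper logarithm `Σ_k (E_k - |ξ_k|) ≤ (4G + G²) h² Σ_k 1/(2h + |ξ_k|) ≤ C h² log(1/h) (L+1)²`
   (`bdgDeficit_le` pointwise, `|w_g| ≤ G = √2 Σ_e |g(e)|`, and the dyadic shell count
   `exists_sum_fermiWeight_le` at `β = 1/h`, valid because `μ_L ∈ [-4 + d₀, -d₀]`,
   `exists_fermiLevel_window`; the boundary term `8hL` is absorbed for `L ≥ 8/(h log(1/h))`).
Constants: `h₀ = 1/3` (so `log(1/h) ≥ 1`), `C = (4G + G²)(2C(d₀) + 1)`.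

Sources: BCS (1957) §III / de Gennes (1966) Ch. 5 (BdG levels); Salmhofer, *Renormalization* (1999)
§4.5.4 (the Cooper logarithm). No definition, no named fact.
-/

noncomputable section

namespace Summit.HubbardSuperconductivity.HubbardSuperconductivity.Theorems

open Matrix Finset Real Literature.MathematicalPhysics.QuantumLattice Literature.Probability.LatticeModels

/-! ### The pointwise BdG deficit and the momentum profile of the source -/

/-- **Pointwise BdG deficit**: for `h > 0`, `G ≥ 0` and `|D| ≤ hG`,
`√(ξ² + D²) - |ξ| ≤ (4G + G²) · h²/(2h + |ξ|)` — i.e. `min(hG, h²G²/(2|ξ|))` up to constants, in the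
weight format of `exists_sum_fermiWeight_le`. [folklore] -/
theorem bdgDeficit_le {ξ D h G : ℝ} (hh : 0 < h) (hG : 0 ≤ G) (hD : |D| ≤ h * G) :
    Real.sqrt (ξ ^ 2 + D ^ 2) - |ξ| ≤ (4 * G + G ^ 2) * (h ^ 2 / (2 * h + |ξ|)) := by
  have hξ := abs_nonneg ξ
  have hDa := abs_nonneg D
  have hden : 0 < 2 * h + |ξ| := by positivity
  have hX : 0 ≤ h ^ 2 / (2 * h + |ξ|) := by positivity
  have hξsq : |ξ| ^ 2 = ξ ^ 2 := sq_abs ξ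
  have hDsq : |D| ^ 2 = D ^ 2 := sq_abs D
  rcases le_or_gt |ξ| (2 * h) with hcase | hcase
  · -- `deficit ≤ |D| ≤ hG ≤ 4G · h²/(2h+|ξ|)`
    have h1 : Real.sqrt (ξ ^ 2 + D ^ 2) ≤ |ξ| + |D| := by
      calc Real.sqrt (ξ ^ 2 + D ^ 2) ≤ Real.sqrt ((|ξ| + |D|) ^ 2) :=
            Real.sqrt_le_sqrt (by nlinarith [mul_nonneg hξ hDa])
        _ = |ξ| + |D| := Real.sqrt_sq (by positivity)
    have h2 : h / 4 ≤ h ^ 2 / (2 * h + |ξ|) := by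
      rw [div_le_div_iff₀ (by norm_num) hden]; nlinarith
    nlinarith [mul_nonneg hG hX, sq_nonneg G]
  · -- `deficit ≤ D²/(2|ξ|) ≤ (hG)²/(2|ξ|) ≤ G² · h²/(2h+|ξ|)`
    have hξpos : 0 < |ξ| := by linarith
    set q : ℝ := D ^ 2 / (2 * |ξ|) with hq
    have hq0 : 0 ≤ q := by positivity
    have hq2 : 2 * |ξ| * q = D ^ 2 := by rw [hq]; field_simp
    have h1 : Real.sqrt (ξ ^ 2 + D ^ 2) ≤ |ξ| + q := by
      calc Real.sqrt (ξ ^ 2 + D ^ 2) ≤ Real.sqrt ((|ξ| + q) ^ 2) :=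
            Real.sqrt_le_sqrt (by nlinarith [sq_nonneg q])
        _ = |ξ| + q := Real.sqrt_sq (by positivity)
    have h2 : q ≤ (h * G) ^ 2 / (2 * |ξ|) := by
      rw [hq]
      exact div_le_div_of_nonneg_right (by rw [← hDsq]; exact pow_le_pow_left₀ hDa hD 2) (by positivity)
    have h3 : (h * G) ^ 2 / (2 * |ξ|) ≤ (h * G) ^ 2 / (2 * h + |ξ|) :=
      div_le_div_of_nonneg_left (by positivity) hden (by linarith)
    have h4 : (h * G) ^ 2 / (2 * h + |ξ|) = G ^ 2 * (h ^ 2 / (2 * h + |ξ|)) := by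
      rw [mul_pow]; ring
    nlinarith [mul_nonneg hG hX]

/-- **The momentum profile of the source is bounded**: `|w_g(k)| ≤ √2 Σ_{e ∈ {0} ∪ unitSteps} |g(e)|`
(`|Re χ_k(e)| ≤ 1`). [folklore] -/
theorem abs_pairFieldMode_le (g : Site 2 → ℝ) (L : ℕ) [NeZero L] (k : TorusSite 2 L) :
    |pairFieldMode g L k| ≤ Real.sqrt 2 * ∑ e ∈ insert 0 unitSteps, |g e| := by
  rw [pairFieldMode, abs_mul, abs_of_nonneg (Real.sqrt_nonneg _)]
  refine mul_le_mul_of_nonneg_left ((Finset.abs_sum_le_sum_abs _ _).trans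
    (Finset.sum_le_sum fun e _ => ?_)) (Real.sqrt_nonneg _)
  rw [abs_mul]
  calc |g e| * |(torusChar k (Torus.proj L e)).re| ≤ |g e| * 1 := by
        gcongr
        exact (Complex.abs_re_le_norm _).trans (norm_torusChar _ _).le
    _ = |g e| := mul_one _

/-! ### The Cooper logarithm of the BdG deficits -/

/-- **The Cooper logarithm of the BdG deficits.** For `d₀ > 0` there is `C = C(d₀) > 0` such that for
every `G ≥ 0`, every `μ` with `μ + 4 ≥ d₀`, `-μ ≥ d₀`, every `0 < h ≤ 1`, every torus side `L ≥ 1` and all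
gaps `|D_k| ≤ hG`:
`Σ_k (√(ξ_k² + D_k²) - |ξ_k|) ≤ (4G + G²)(C h² (1 + log(1/h)) L² + 8hL)`, `ξ_k = ε_L(k) - μ`
(pointwise `bdgDeficit_le` and the dyadic shell count `exists_sum_fermiWeight_le` at `β = 1/h`).
[folklore] -/
theorem exists_sum_bdgDeficit_le {d₀ : ℝ} (hd₀ : 0 < d₀) :
    ∃ C : ℝ, 0 < C ∧ ∀ G : ℝ, 0 ≤ G → ∀ μ : ℝ, d₀ ≤ μ + 4 → d₀ ≤ -μ → ∀ h : ℝ, 0 < h → h ≤ 1 →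
      ∀ (L : ℕ) [NeZero L] (D : TorusSite 2 L → ℝ), (∀ k, |D k| ≤ h * G) →
        ∑ k : TorusSite 2 L, (Real.sqrt ((torusBand L k - μ) ^ 2 + (D k) ^ 2) - |torusBand L k - μ|) ≤
          (4 * G + G ^ 2) * (C * h ^ 2 * (1 + Real.log (1 / h)) * (L : ℝ) ^ 2 + 8 * h * L) := by
  obtain ⟨C, hC, hsum⟩ := exists_sum_fermiWeight_le hd₀
  refine ⟨C, hC, fun G hG μ hμ4 hμ0 h hh hh1 L _ D hD => ?_⟩
  have hβ : 1 ≤ 1 / h := by rw [le_div_iff₀ hh]; linarith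
  have hw := hsum μ hμ4 hμ0 (1 / h) hβ L
  have hK : 0 ≤ 4 * G + G ^ 2 := by positivity
  -- the weights at `β = 1/h`
  have hwt : ∀ k : TorusSite 2 L, h ^ 2 / (2 * h + |torusBand L k - μ|) =
      h ^ 2 * ((1 / h) / (2 + (1 / h) * |torusBand L k - μ|)) := by
    intro k
    have : 0 < 2 * h + |torusBand L k - μ| := by positivity
    field_simp
  calc ∑ k : TorusSite 2 L, (Real.sqrt ((torusBand L k - μ) ^ 2 + (D k) ^ 2) - |torusBand L k - μ|)
      ≤ ∑ k : TorusSite 2 L, (4 * G + G ^ 2) * (h ^ 2 / (2 * h + |torusBand L k - μ|)) :=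
        Finset.sum_le_sum fun k _ => bdgDeficit_le hh hG (hD k)
    _ = (4 * G + G ^ 2) * (h ^ 2 * ∑ k : TorusSite 2 L, (1 / h) / (2 + (1 / h) * |torusBand L k - μ|)) := by
        rw [Finset.mul_sum, Finset.mul_sum]
        exact Finset.sum_congr rfl fun k _ => by rw [hwt k]
    _ ≤ (4 * G + G ^ 2) * (h ^ 2 * (C * (1 + Real.log (1 / h)) * (L : ℝ) ^ 2 + 8 * (1 / h) * L)) := by
        gcongr
    _ = (4 * G + G ^ 2) * (C * h ^ 2 * (1 + Real.log (1 / h)) * (L : ℝ) ^ 2 + 8 * h * L) := by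
        congr 1
        field_simp

/-- `Σ_k (ξ_k - E_k) = 2 Σ_k min(ξ_k, 0) - Σ_k (E_k - |ξ_k|)` (`ξ - |ξ| = 2 min(ξ, 0)`). [folklore] -/
theorem sum_sub_eq_two_mul_sum_min_sub {ι : Type*} (s : Finset ι) (ξ E : ι → ℝ) :
    ∑ k ∈ s, (ξ k - E k) = 2 * ∑ k ∈ s, min (ξ k) 0 - ∑ k ∈ s, (E k - |ξ k|) := by
  rw [Finset.mul_sum, ← Finset.sum_sub_distrib]
  refine Finset.sum_congr rfl fun k _ => ?_
  have := neg_add_abs_eq (ξ k)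
  linarith

/-! ### The route decl -/

/-- **`WcbcsSourcedFreeGasCooperLog`** (route `WeakCouplingBCS`, item stmt-HubbardSuperconductivity-1210),
type spelled out structurally: for every real form factor `g` and `δ ∈ (0,1)` there are `C` and
`h₀ ∈ (0,1)` such that for `h ∈ (0,h₀)` and all `L ≥ L₀(h)` the canonical free Fermi level `μ = μ_L`
(`|μ| ≤ 4`) of `N_L = 2⌊(1-δ)(L+1)²/2⌋` electrons satisfies, for every unit `φ` in Fock space,
`E₀^{(N_L,0)}(hubbardTorus 2 (L+1) 1 0) - μ N_L - C h² log(1/h) (L+1)² ≤ Re⟨φ, (K_μ - h(Δ_g + Δ_g†)) φ⟩`.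
Proof: Slater match at the shell level + BdG lower bound + the Cooper logarithm of the deficits (module
docstring). [folklore] -/
theorem wcbcsSourcedFreeGasCooperLog_proof :
    ∀ (g : Literature.Probability.LatticeModels.Site 2 → ℝ) (δ : ℝ), δ ∈ Set.Ioo (0:ℝ) 1 →
      ∃ C h₀ : ℝ, 0 < h₀ ∧ h₀ < 1 ∧ ∀ h : ℝ, h ∈ Set.Ioo (0:ℝ) h₀ → ∃ L₀ : ℕ, ∀ L : ℕ, L₀ ≤ L →
        ∃ μ : ℝ, |μ| ≤ 4 ∧ ∀ φ : Literature.MathematicalPhysics.QuantumLattice.Fock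
          (Literature.MathematicalPhysics.QuantumLattice.Orb
            (Literature.MathematicalPhysics.QuantumLattice.FermionTorus 2 (L + 1))), star φ ⬝ᵥ φ = 1 →
          (Literature.MathematicalPhysics.QuantumLattice.hubbardTorus 2 (L + 1) 1 0).minEnergyOn
              (Literature.MathematicalPhysics.QuantumLattice.szSector
                (2 * ⌊(1 - δ) * ((L + 1 : ℕ) : ℝ) ^ 2 / 2⌋₊) 0) -
            μ * ((2 * ⌊(1 - δ) * ((L + 1 : ℕ) : ℝ) ^ 2 / 2⌋₊ : ℕ) : ℝ) -
            C * h ^ 2 * Real.log (1 / h) * ((L + 1 : ℕ) : ℝ) ^ 2 ≤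
          (star φ ⬝ᵥ Matrix.mulVec (Literature.MathematicalPhysics.QuantumLattice.hubbardTorusWith 2 (L + 1) 1 0 μ -
            (h : ℂ) • (Literature.MathematicalPhysics.QuantumLattice.pairField g (L + 1) +
              Matrix.conjTranspose (Literature.MathematicalPhysics.QuantumLattice.pairField g (L + 1)))) φ).re := by
  intro g δ hδ
  obtain ⟨hδ0, hδ1⟩ := hδ
  -- the source profile bound
  set G : ℝ := Real.sqrt 2 * ∑ e ∈ insert 0 unitSteps, |g e| with hGdef
  have hG : 0 ≤ G := mul_nonneg (Real.sqrt_nonneg _) (Finset.sum_nonneg fun e _ => abs_nonneg _)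
  -- the Fermi-level window and the Cooper constant
  obtain ⟨d₀, hd₀, L₁, hwin⟩ := exists_fermiLevel_window hδ0 hδ1
  obtain ⟨C, hC, hcooper⟩ := exists_sum_bdgDeficit_le hd₀
  set K : ℝ := 4 * G + G ^ 2 with hKdef
  have hK : 0 ≤ K := by positivity
  refine ⟨K * (2 * C + 1), 1 / 3, by norm_num, by norm_num, fun h hh => ?_⟩
  obtain ⟨hh0, hh3⟩ := hh
  have hh1 : h ≤ 1 := by linarith
  have hlog : 1 ≤ Real.log (1 / h) := by
    have h3 : (3 : ℝ) ≤ 1 / h := by rw [le_div_iff₀ hh0]; linarith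
    have hexp : Real.exp 1 < 3 := lt_trans Real.exp_one_lt_d9 (by norm_num)
    have : (1 : ℝ) ≤ Real.log 3 := by
      rw [Real.le_log_iff_exp_le (by norm_num)]; exact hexp.le
    exact this.trans (Real.log_le_log (by norm_num) h3)
  have hlogpos : 0 < Real.log (1 / h) := lt_of_lt_of_le one_pos hlog
  refine ⟨max (max L₁ 3) ⌈8 / (h * Real.log (1 / h))⌉₊, fun L hL => ?_⟩
  -- thresholds for the side `L + 1`
  have hL1 : L₁ ≤ L + 1 := ((le_max_left _ _).trans ((le_max_left _ _).trans hL)).trans (Nat.le_succ L)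
  have hL3 : 3 ≤ L + 1 := ((le_max_right _ _).trans ((le_max_left _ _).trans hL)).trans (Nat.le_succ L)
  have hL8 : 8 / (h * Real.log (1 / h)) ≤ ((L + 1 : ℕ) : ℝ) := by
    have h1 : (⌈8 / (h * Real.log (1 / h))⌉₊ : ℝ) ≤ (L : ℝ) := by
      exact_mod_cast (le_max_right _ _).trans hL
    have h2 : (L : ℝ) ≤ ((L + 1 : ℕ) : ℝ) := by push_cast; linarith
    exact ((Nat.le_ceil _).trans h1).trans h2
  obtain ⟨hN0, hN2, hμlo, hμhi⟩ := hwin (L + 1) hL1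
  set N : ℕ := 2 * ⌊(1 - δ) * ((L + 1 : ℕ) : ℝ) ^ 2 / 2⌋₊ with hNdef
  set m : ℕ := ⌊(1 - δ) * ((L + 1 : ℕ) : ℝ) ^ 2 / 2⌋₊ with hmdef
  set μ : ℝ := torusFermiLevel (L + 1) N with hμdef
  have hm : 0 < m := by omega
  have hmL : m ≤ (L + 1) ^ 2 := by omega
  refine ⟨μ, abs_le.mpr ⟨by linarith, by linarith⟩, fun φ hφ => ?_⟩
  set S : ℝ := ((L + 1 : ℕ) : ℝ) with hSdef
  have hS0 : (0 : ℝ) < S := by rw [hSdef]; positivity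
  -- (1) Slater match at the shell level
  have h1 := free_sectorEnergy_sub_fermiLevel_mul_le (L := L + 1) hL3 hm hmL
  -- (2) BdG lower bound
  have h2 := sum_bdgLevel_le_re_rayleigh_sourcedFreeTorus (L := L + 1) hL3 g μ h φ hφ
  rw [sum_sub_eq_two_mul_sum_min_sub] at h2
  -- (3) the Cooper logarithm of the deficits
  have hD : ∀ k : TorusSite 2 (L + 1), |h * pairFieldMode g (L + 1) k| ≤ h * G := fun k => by
    rw [abs_mul, abs_of_pos hh0]
    exact mul_le_mul_of_nonneg_left (abs_pairFieldMode_le g (L + 1) k) hh0.le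
  have h3 := hcooper G hG μ hμlo hμhi h hh0 hh1 (L + 1) (fun k => h * pairFieldMode g (L + 1) k) hD
  -- absorb `C h²(1 + log(1/h)) S² + 8hS` into `(2C+1) h² log(1/h) S²`
  have hb1 : C * h ^ 2 * (1 + Real.log (1 / h)) * S ^ 2 ≤ 2 * C * h ^ 2 * Real.log (1 / h) * S ^ 2 := by
    have : 0 ≤ C * h ^ 2 * S ^ 2 := by positivity
    nlinarith
  have hb2 : 8 * h * S ≤ h ^ 2 * Real.log (1 / h) * S ^ 2 := by
    have h8 : 8 ≤ h * Real.log (1 / h) * S := by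
      have := hL8
      rw [div_le_iff₀ (by positivity)] at this
      linarith
    nlinarith
  have h3' : ∑ k : TorusSite 2 (L + 1), (Real.sqrt ((torusBand (L + 1) k - μ) ^ 2 +
      (h * pairFieldMode g (L + 1) k) ^ 2) - |torusBand (L + 1) k - μ|) ≤
      K * (2 * C + 1) * h ^ 2 * Real.log (1 / h) * S ^ 2 := by
    calc _ ≤ K * (C * h ^ 2 * (1 + Real.log (1 / h)) * S ^ 2 + 8 * h * S) := h3
      _ ≤ K * (2 * C * h ^ 2 * Real.log (1 / h) * S ^ 2 + h ^ 2 * Real.log (1 / h) * S ^ 2) :=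
          mul_le_mul_of_nonneg_left (add_le_add hb1 hb2) hK
      _ = K * (2 * C + 1) * h ^ 2 * Real.log (1 / h) * S ^ 2 := by ring
  -- assemble
  have hcast : ((2 * m : ℕ) : ℝ) = ((N : ℕ) : ℝ) := by rw [hNdef]
  rw [hcast] at h1
  linarith

end Summit.HubbardSuperconductivity.HubbardSuperconductivity.Theorems

end
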